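import Summits.NavierStokesRegularity.NavierStokesRegularity.Theorems.SqueezeCycleRecurrentLiouvilleRotationalAbsorptionFast
import Literature.Analysis.FluidPDE.KNSSTypeIRateLimit

/-!
# Crux `SymmetricScarExists` (stmt-NavierStokesRegularity-11718), line `rdss-screw-split` — stub
# `stub_rotationOrbitContinuity` (AUX-9): the rotation orbit of an `L³_loc` field is continuous in
# `L³(Q(0, R))`

Helper file of the line lead (`--supports stmt-NavierStokesRegularity-11718`; theorems only, no
definitions, no named facts), pure real analysis.  For a space–time field `u : ℝ → ℝ³ → ℝ³` lying in
`L³(Q(0, R))` (`Q(0, R) = ]-R², 0[ × B(0, R)` = `parabolicCylinder R 0`) and angles `θ_j → θ₀`, the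
rotation-conjugates `(C_θ u)(t, x) = R_θ u(t, R_{−θ} x)` (`R_θ = rotZ θ`, the rotation about `e₃`)
satisfy `‖C_{θ_j} u − C_{θ₀} u‖_{L³(Q(0,R))} → 0` (`stub_rotationOrbitContinuity`): the rotation group
acts strongly continuously on `L³(Q(0, R))`.

Proof (the classical `3ε` argument for the continuity of translations in `L^p`): truncate `u` to
`Q(0, R)` and approximate in `L³(ℝ × ℝ³)` by a continuous compactly supported `g`
(`MeasureTheory.MemLp.exists_hasCompactSupport_eLpNorm_sub_le`); split
`C_θ u − C_{θ₀} u = (C_θ u − C_θ g) + (C_θ g − C_{θ₀} g) + (C_{θ₀} g − C_{θ₀} u)` on `Q(0, R)`.  The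
conjugation `C_θ` is an isometry of `L³(Q(0, R))` (the space–time rotation preserves Lebesgue measure
restricted to the rotation-invariant cylinder, `rlRotAbs_eLpNorm_conj`), so the two outer terms are
`‖u − g‖_{L³(Q(0,R))}`, and the middle one is uniformly small on `Q(0, R)` for `θ` near `θ₀` because
`(θ, z) ↦ (C_θ g)(z)` is jointly continuous, hence uniformly continuous in `θ` transversally to the
compact box `[-R², 0] × B̄(0, R)` (`IsCompact.mem_uniformity_of_prod`); conclude with
`eLpNorm_le_of_ae_bound` on the finite-measure cylinder.

## References

* W. Rudin, *Real and Complex Analysis*, 3rd ed., Thm. 9.5 (continuity of translation in `L^p`;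
  the same `3ε` argument for any strongly measure-preserving continuous group action). [folklore]
-/

noncomputable section

open MeasureTheory Set Function Filter Topology TopologicalSpace Metric
open scoped NNReal ENNReal

namespace Summit.NavierStokesRegularity.NavierStokesRegularity.Theorems.SymmetricScarExists.RdssSplit.NearIdentity

set_option linter.dupNamespace false

open Literature.Analysis.FluidPDE

/-- **Uniform smallness of `R_θ g(t, R_{−θ} x) − R_{θ₀} g(t, R_{−θ₀} x)` on a backward cylinder.**  For a
continuous `g` on `ℝ × ℝ³`, any `R`, `θ₀` and `η > 0`, every `θ` close enough to `θ₀` satisfies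
`‖R_θ g(t, R_{−θ} x) − R_{θ₀} g(t, R_{−θ₀} x)‖ ≤ η` for all `(t, x) ∈ Q(0, R)`: the map
`(θ, z) ↦ R_θ g(z.1, R_{−θ} z.2)` is jointly continuous, hence transversally uniformly continuous along
the compact box `[-R², 0] × B̄(0, R) ⊇ Q(0, R)`. [folklore] -/
theorem rotOrbitContinuity_uniform
    {g : ℝ × EuclideanSpace ℝ (Fin 3) → EuclideanSpace ℝ (Fin 3)} (hg : Continuous g)
    (R θ₀ : ℝ) {η : ℝ} (hη : 0 < η) :
    ∀ᶠ θ : ℝ in 𝓝 θ₀, ∀ z ∈ parabolicCylinder R (0 : ℝ × EuclideanSpace ℝ (Fin 3)),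
      ‖rotZ θ (g (z.1, rotZ (-θ) z.2)) - rotZ θ₀ (g (z.1, rotZ (-θ₀) z.2))‖ ≤ η := by
  -- joint continuity of the conjugation family
  have h1 : Continuous fun p : ℝ × (ℝ × EuclideanSpace ℝ (Fin 3)) => rotZ (-p.1) p.2.2 :=
    Literature.Analysis.FluidPDE.continuous_rotZ_uncurry.comp
      (f := fun p : ℝ × (ℝ × EuclideanSpace ℝ (Fin 3)) =>
        ((-p.1, p.2.2) : ℝ × EuclideanSpace ℝ (Fin 3)))
      (continuous_fst.neg.prodMk continuous_snd.snd)
  have h2 : Continuous fun p : ℝ × (ℝ × EuclideanSpace ℝ (Fin 3)) => g (p.2.1, rotZ (-p.1) p.2.2) :=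
    hg.comp (continuous_snd.fst.prodMk h1)
  have hGc : Continuous (uncurry fun (θ : ℝ) (z : ℝ × EuclideanSpace ℝ (Fin 3)) =>
      rotZ θ (g (z.1, rotZ (-θ) z.2))) := by
    show Continuous fun p : ℝ × (ℝ × EuclideanSpace ℝ (Fin 3)) =>
      rotZ p.1 (g (p.2.1, rotZ (-p.1) p.2.2))
    exact Literature.Analysis.FluidPDE.continuous_rotZ_uncurry.comp
      (f := fun p : ℝ × (ℝ × EuclideanSpace ℝ (Fin 3)) =>
        ((p.1, g (p.2.1, rotZ (-p.1) p.2.2)) : ℝ × EuclideanSpace ℝ (Fin 3)))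
      (continuous_fst.prodMk h2)
  -- the compact box `[-R², 0] × B̄(0, R)` contains `Q(0, R)`
  have hK : IsCompact (Icc (-R ^ 2) 0 ×ˢ closedBall (0 : EuclideanSpace ℝ (Fin 3)) R) :=
    isCompact_Icc.prod (isCompact_closedBall 0 R)
  have hQK : parabolicCylinder R (0 : ℝ × EuclideanSpace ℝ (Fin 3)) ⊆
      Icc (-R ^ 2) 0 ×ˢ closedBall (0 : EuclideanSpace ℝ (Fin 3)) R := by
    intro z hz
    rw [SuitableCompactness.mem_parabolicCylinder_zero] at hz
    exact ⟨⟨hz.1.1.le, hz.1.2.le⟩, mem_closedBall_zero_iff.2 hz.2.le⟩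
  obtain ⟨v, hv, hvK⟩ := hK.mem_uniformity_of_prod (s := univ) (q := θ₀) hGc.continuousOn
    (mem_univ θ₀) (Metric.dist_mem_uniformity hη)
  rw [nhdsWithin_univ] at hv
  filter_upwards [hv] with θ hθ z hz
  have h : dist (rotZ θ (g (z.1, rotZ (-θ) z.2))) (rotZ θ₀ (g (z.1, rotZ (-θ₀) z.2))) < η :=
    hvK θ hθ z (hQK hz)
  rw [dist_eq_norm] at h
  exact h.le

/-- The three-term splitting `‖X − Y‖ ≤ ‖X − G‖ + ‖G − H‖ + ‖H − Y‖` in `L³`. [folklore] -/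
theorem rotOrbitContinuity_three_terms {μ : Measure (ℝ × EuclideanSpace ℝ (Fin 3))}
    {X Y G H : ℝ × EuclideanSpace ℝ (Fin 3) → EuclideanSpace ℝ (Fin 3)}
    (hX : AEStronglyMeasurable X μ) (hY : AEStronglyMeasurable Y μ)
    (hG : AEStronglyMeasurable G μ) (hH : AEStronglyMeasurable H μ) :
    eLpNorm (X - Y) 3 μ ≤ eLpNorm (X - G) 3 μ + eLpNorm (G - H) 3 μ + eLpNorm (H - Y) 3 μ := by
  have h13 : (1 : ℝ≥0∞) ≤ 3 := by norm_num
  calc eLpNorm (X - Y) 3 μ = eLpNorm ((X - G) + ((G - H) + (H - Y))) 3 μ := by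
        rw [sub_add_sub_cancel, sub_add_sub_cancel]
    _ ≤ eLpNorm (X - G) 3 μ + eLpNorm ((G - H) + (H - Y)) 3 μ :=
        eLpNorm_add_le (hX.sub hG) ((hG.sub hH).add (hH.sub hY)) h13
    _ ≤ eLpNorm (X - G) 3 μ + (eLpNorm (G - H) 3 μ + eLpNorm (H - Y) 3 μ) :=
        add_le_add le_rfl (eLpNorm_add_le (hG.sub hH) (hH.sub hY) h13)
    _ = _ := (add_assoc _ _ _).symm

/-- **The rotation orbit is continuous in `L³(Q(0, R))` (filter form).**  If `u ∈ L³(Q(0, R))`, then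
`θ ↦ C_θ u`, `(C_θ u)(t, x) = R_θ u(t, R_{−θ} x)`, is continuous at every `θ₀` in `L³(Q(0, R))`:
`‖C_θ u − C_{θ₀} u‖_{L³(Q(0,R))} → 0` as `θ → θ₀`.  Approximate the truncation of `u` in `L³(volume)`
by a continuous compactly supported `g` (`MeasureTheory.MemLp.exists_hasCompactSupport_eLpNorm_sub_le`);
the outer terms of `(C_θ u − C_θ g) + (C_θ g − C_{θ₀} g) + (C_{θ₀} g − C_{θ₀} u)` are
`‖u − g‖_{L³(Q(0,R))}` (`rlRotAbs_eLpNorm_conj`), the middle one is uniformly small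
(`rotOrbitContinuity_uniform`) and then small in `L³` by `eLpNorm_le_of_ae_bound`. [folklore] -/
theorem rotOrbitContinuity_tendsto
    {u : ℝ → EuclideanSpace ℝ (Fin 3) → EuclideanSpace ℝ (Fin 3)} {R : ℝ}
    (hu : MemLp (uncurry u) 3
      (volume.restrict (parabolicCylinder R (0 : ℝ × EuclideanSpace ℝ (Fin 3))))) (θ₀ : ℝ) :
    Tendsto (fun θ : ℝ => eLpNorm (uncurry (fun t x => rotZ θ (u t (rotZ (-θ) x))) -
        uncurry (fun t x => rotZ θ₀ (u t (rotZ (-θ₀) x)))) 3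
        (volume.restrict (parabolicCylinder R (0 : ℝ × EuclideanSpace ℝ (Fin 3))))) (𝓝 θ₀) (𝓝 0) := by
  set μR : Measure (ℝ × EuclideanSpace ℝ (Fin 3)) :=
    volume.restrict (parabolicCylinder R (0 : ℝ × EuclideanSpace ℝ (Fin 3))) with hμR
  rw [ENNReal.tendsto_nhds_zero]
  intro ε hε
  -- the constants: `V = |Q(0,R)|^{1/3}`, `η = min (ε / (3 (V + 1))) 1`
  set V : ℝ≥0∞ := volume (parabolicCylinder R (0 : ℝ × EuclideanSpace ℝ (Fin 3))) ^
    (3 : ℝ≥0∞).toReal⁻¹ with hV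
  have hVtop : V ≠ ⊤ := ENNReal.rpow_ne_top_of_nonneg (by norm_num)
    (SuitableCompactness.volume_parabolicCylinder_zero_ne_top R)
  set A : ℝ≥0∞ := V + 1 with hA
  have hAtop : A ≠ ⊤ := ENNReal.add_ne_top.2 ⟨hVtop, ENNReal.one_ne_top⟩
  have h1A : 1 ≤ A := le_add_self
  have hA0 : A ≠ 0 := (lt_of_lt_of_le one_pos h1A).ne'
  set δ : ℝ≥0∞ := ε / 3 with hδ
  have hδ0 : δ ≠ 0 := (ENNReal.div_pos hε.ne' (by norm_num)).ne'
  set η : ℝ≥0∞ := min (δ / A) 1 with hη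
  have hη0 : η ≠ 0 := (lt_min (ENNReal.div_pos hδ0 hAtop) one_pos).ne'
  have hηtop : η ≠ ⊤ := ne_top_of_le_ne_top ENNReal.one_ne_top (min_le_right _ _)
  have hAη : A * η ≤ δ :=
    (mul_le_mul' le_rfl (min_le_left _ _)).trans_eq (ENNReal.mul_div_cancel hA0 hAtop)
  have hVη : V * η ≤ δ := (mul_le_mul' (le_self_add : V ≤ V + 1) le_rfl).trans hAη
  have hηδ : η ≤ δ := (le_mul_of_one_le_left bot_le h1A).trans hAη
  have hη'0 : 0 < η.toReal := ENNReal.toReal_pos hη0 hηtop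
  have hofReal : ENNReal.ofReal η.toReal = η := ENNReal.ofReal_toReal hηtop
  -- truncation to `Q(0, R)` and `C_c` approximation
  have hmeas : MeasurableSet (parabolicCylinder R (0 : ℝ × EuclideanSpace ℝ (Fin 3))) :=
    (isOpen_parabolicCylinder _ _).measurableSet
  set f : ℝ × EuclideanSpace ℝ (Fin 3) → EuclideanSpace ℝ (Fin 3) :=
    (parabolicCylinder R (0 : ℝ × EuclideanSpace ℝ (Fin 3))).indicator (uncurry u) with hf
  have hfL : MemLp f 3 volume := by
    rw [hf, memLp_indicator_iff_restrict hmeas]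
    exact hu
  obtain ⟨g, -, hfg, hgc, -⟩ :=
    hfL.exists_hasCompactSupport_eLpNorm_sub_le (by norm_num : (3 : ℝ≥0∞) ≠ ⊤) hη0
  have hgm : AEStronglyMeasurable g μR := hgc.aestronglyMeasurable
  have hum : AEStronglyMeasurable (uncurry u) μR := hu.1
  -- on `Q(0, R)` the field `u` is its truncation `f`, so `‖u − g‖_{L³(Q(0,R))} ≤ η`
  have huf : (uncurry u : ℝ × EuclideanSpace ℝ (Fin 3) → EuclideanSpace ℝ (Fin 3)) =ᵐ[μR] f := by
    filter_upwards [ae_restrict_mem hmeas] with z hz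
    rw [hf, indicator_of_mem hz]
  have hug : eLpNorm (uncurry u - g) 3 μR ≤ η := by
    calc eLpNorm (uncurry u - g) 3 μR = eLpNorm (f - g) 3 μR :=
          eLpNorm_congr_ae (huf.sub (ae_eq_refl g))
      _ ≤ eLpNorm (f - g) 3 volume := eLpNorm_mono_measure _ Measure.restrict_le_self
      _ ≤ η := hfg
  -- measurability of the conjugates on `Q(0, R)`
  have hcu : ∀ θ : ℝ, AEStronglyMeasurable (uncurry (fun t x => rotZ θ (u t (rotZ (-θ) x)))) μR :=
    fun θ => rlRotAbs_aesm_conj θ R (g := uncurry u) hum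
  have hcg : ∀ θ : ℝ, AEStronglyMeasurable
      (fun z : ℝ × EuclideanSpace ℝ (Fin 3) => rotZ θ (g (z.1, rotZ (-θ) z.2))) μR :=
    fun θ => rlRotAbs_aesm_conj θ R hgm
  -- the outer terms: the conjugation is an isometry of `L³(Q(0, R))`
  have hT13 : ∀ θ : ℝ, eLpNorm (uncurry (fun t x => rotZ θ (u t (rotZ (-θ) x))) -
      (fun z : ℝ × EuclideanSpace ℝ (Fin 3) => rotZ θ (g (z.1, rotZ (-θ) z.2)))) 3 μR ≤ η := by
    intro θ
    calc eLpNorm (uncurry (fun t x => rotZ θ (u t (rotZ (-θ) x))) -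
          (fun z : ℝ × EuclideanSpace ℝ (Fin 3) => rotZ θ (g (z.1, rotZ (-θ) z.2)))) 3 μR
        = eLpNorm (fun z : ℝ × EuclideanSpace ℝ (Fin 3) =>
            rotZ θ (uncurry u (z.1, rotZ (-θ) z.2)) - rotZ θ (g (z.1, rotZ (-θ) z.2))) 3 μR := rfl
      _ = eLpNorm (uncurry u - g) 3 μR := rlRotAbs_eLpNorm_conj θ R hum hgm
      _ ≤ η := hug
  filter_upwards [rotOrbitContinuity_uniform hgc R θ₀ hη'0] with θ hθ
  -- the middle term: uniformly small, hence small in `L³` on the finite-measure cylinder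
  have hT2 : eLpNorm ((fun z : ℝ × EuclideanSpace ℝ (Fin 3) => rotZ θ (g (z.1, rotZ (-θ) z.2))) -
      (fun z : ℝ × EuclideanSpace ℝ (Fin 3) => rotZ θ₀ (g (z.1, rotZ (-θ₀) z.2)))) 3 μR ≤ V * η := by
    have hbound : ∀ᵐ z ∂μR, ‖((fun z : ℝ × EuclideanSpace ℝ (Fin 3) =>
        rotZ θ (g (z.1, rotZ (-θ) z.2))) -
        (fun z : ℝ × EuclideanSpace ℝ (Fin 3) => rotZ θ₀ (g (z.1, rotZ (-θ₀) z.2)))) z‖ ≤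
        η.toReal := by
      filter_upwards [ae_restrict_mem hmeas] with z hz
      exact hθ z hz
    calc eLpNorm ((fun z : ℝ × EuclideanSpace ℝ (Fin 3) => rotZ θ (g (z.1, rotZ (-θ) z.2))) -
          (fun z : ℝ × EuclideanSpace ℝ (Fin 3) => rotZ θ₀ (g (z.1, rotZ (-θ₀) z.2)))) 3 μR
        ≤ μR univ ^ (3 : ℝ≥0∞).toReal⁻¹ * ENNReal.ofReal η.toReal := eLpNorm_le_of_ae_bound hbound
      _ = V * η := by rw [hμR, Measure.restrict_apply_univ, hofReal]
  -- the last term, with the isometry read backwards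
  have hT3 : eLpNorm ((fun z : ℝ × EuclideanSpace ℝ (Fin 3) => rotZ θ₀ (g (z.1, rotZ (-θ₀) z.2))) -
      uncurry (fun t x => rotZ θ₀ (u t (rotZ (-θ₀) x)))) 3 μR ≤ η := by
    rw [eLpNorm_sub_comm]
    exact hT13 θ₀
  calc eLpNorm (uncurry (fun t x => rotZ θ (u t (rotZ (-θ) x))) -
        uncurry (fun t x => rotZ θ₀ (u t (rotZ (-θ₀) x)))) 3 μR
      ≤ eLpNorm (uncurry (fun t x => rotZ θ (u t (rotZ (-θ) x))) -
            (fun z : ℝ × EuclideanSpace ℝ (Fin 3) => rotZ θ (g (z.1, rotZ (-θ) z.2)))) 3 μR +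
          eLpNorm ((fun z : ℝ × EuclideanSpace ℝ (Fin 3) => rotZ θ (g (z.1, rotZ (-θ) z.2))) -
            (fun z : ℝ × EuclideanSpace ℝ (Fin 3) => rotZ θ₀ (g (z.1, rotZ (-θ₀) z.2)))) 3 μR +
          eLpNorm ((fun z : ℝ × EuclideanSpace ℝ (Fin 3) => rotZ θ₀ (g (z.1, rotZ (-θ₀) z.2))) -
            uncurry (fun t x => rotZ θ₀ (u t (rotZ (-θ₀) x)))) 3 μR :=
        rotOrbitContinuity_three_terms (hcu θ) (hcu θ₀) (hcg θ) (hcg θ₀)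
    _ ≤ η + V * η + η := add_le_add (add_le_add (hT13 θ) hT2) hT3
    _ ≤ δ + δ + δ := add_le_add (add_le_add hηδ hVη) hηδ
    _ = ε := by rw [hδ, ENNReal.add_thirds]

/-- AUX-9 `stub_rotationOrbitContinuity` — **the rotation orbit of an `L³_loc` field is continuous in
`L³(Q(0, R))`** (sequential form): if `u ∈ L³(Q(0, R))` for every `R > 0` and `θ_j → θ₀`, then
`‖R_{θ_j} u(t, R_{−θ_j} x) − R_{θ₀} u(t, R_{−θ₀} x)‖_{L³(Q(0,R))} → 0` for every `R > 0`.  The `3ε`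
argument (`rotOrbitContinuity_tendsto`: `C_c` approximation in `L³`, the conjugation by a rotation is an
isometry of `L³(Q(0, R))`, uniform continuity for the middle term), composed with `θ_j → θ₀`. [folklore] -/
theorem stub_rotationOrbitContinuity : ∀ (u : ℝ → EuclideanSpace ℝ (Fin 3) → EuclideanSpace ℝ (Fin 3)), (∀ R : ℝ, 0 < R → MeasureTheory.MemLp (Function.uncurry u) 3 (MeasureTheory.volume.restrict (Literature.Analysis.FluidPDE.parabolicCylinder R (0 : ℝ × EuclideanSpace ℝ (Fin 3))))) → ∀ (θ : ℕ → ℝ) (θ₀ : ℝ), Filter.Tendsto θ Filter.atTop (nhds θ₀) → ∀ R : ℝ, 0 < R → Filter.Tendsto (fun j : ℕ => MeasureTheory.eLpNorm (Function.uncurry (fun t x => Literature.Analysis.FluidPDE.rotZ (θ j) (u t (Literature.Analysis.FluidPDE.rotZ (-(θ j)) x))) - Function.uncurry (fun t x => Literature.Analysis.FluidPDE.rotZ θ₀ (u t (Literature.Analysis.FluidPDE.rotZ (-θ₀) x)))) 3 (MeasureTheory.volume.restrict (Literature.Analysis.FluidPDE.parabolicCylinder R (0 : ℝ × EuclideanSpace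 ℝ (Fin 3))))) Filter.atTop (nhds 0) := by
  intro u hu θ θ₀ hθ R hR
  exact (rotOrbitContinuity_tendsto (hu R hR) θ₀).comp hθ

end Summit.NavierStokesRegularity.NavierStokesRegularity.Theorems.SymmetricScarExists.RdssSplit.NearIdentity
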